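import Mathlib
import Summits.ValiantsHypothesis.ValiantsHypothesis.Theorems.BarrierLeverPartitionMinorsHitByVPSimplexJoinThreeSlots
import Summits.ValiantsHypothesis.ValiantsHypothesis.Theorems.BarrierLeverPartitionMinorsHitByVPSimplexJoinPatternOneZero
import Summits.ValiantsHypothesis.ValiantsHypothesis.Theorems.BarrierLeverPartitionMinorsHitByVPHiddenStatesUniversalConstraints

/-!
# Route BarrierLever — item `PartitionMinorsHitByVP` (19717): `Stmt.pieceKillMany`, three live slots — patterns (2,0,0) and (0,0,0)
Helper file (`--supports stmt-ValiantsHypothesis-19717`; cell valiant-natproofs, 𝒟-side door (c), line `hidden_states`, uniform-menu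
lane; prover seat val-np-p3 gen 12). Definition-free; closes NO item. First two of the k = 3 shallow patterns of the case map toward
`Stmt.pieceKillMany H₀` (memo val-np-p3 g12 §2(j)), on the generic **three-slot all-small leaf** `leaf3_allSmall` (inside `|A| = a ≤ h`
coordinates, slots deep at levels `m₁,m₂,m₃` w.r.t. `a`, all `n ≤ C(a, ≤ m₁+m₂+m₃+2)` smallest rows; the three-slot lemma p631390):
* **`pieceKill3_p200`** — levels (2,0,0) at `univ` (`s₁ ≥ 1+h+C(h,2)`, `1 ≤ s₃ ≤ s₂ ≤ h`): leaf (2,0,0) at `a = h` if `24n ≤ (h−3)⁴`, else leaf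
  (2,1,0) inside `a = s₂ − 1` (`cover200`: then `120n ≤ (s₂−6)⁵`);
* **`pieceKill3_p000`** — levels (0,0,0) (`1 ≤ s₃ ≤ s₂ ≤ s₁ ≤ h`, `n ≥ (2h)²+2`): leaf (1,1,0) inside `a = s₂−1` if `24n ≤ (s₂−4)⁴`, leaf (1,1,1)
  inside `a = s₃−1` if `120n ≤ (s₃−5)⁵`, and `cover000` shows one of them fires (`h ≥ 2^40`).
Remaining k = 3 patterns: (1,0,0), (1,1,0); then k = 4, 5 and the dispatch. Nothing on crux 14610 or VP ≠ VNP.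
-/

set_option linter.dupNamespace false

namespace Summit.ValiantsHypothesis.ValiantsHypothesis.Theorems.BarrierLever.SimplexJoin

open Finset Matrix
open Summit.ValiantsHypothesis.ValiantsHypothesis.Theorems.BarrierLever.HiddenStates.UniversalConstraints
  (rowsSmallFirst rowsSmallFirst_injective card_small_rowsSmallFirst)

variable {D N n : ℕ}

/-- **Generic three-slot all-small leaf** inside `|A| = a ≤ h` coordinates. -/
theorem leaf3_allSmall (h m₁ m₂ m₃ a : ℕ) (S : Fin 1 → Fin D → Finset (Fin N))
    (e : Fin n → Fin 1 × (Fin D → Option (Fin N))) (he : Function.Injective e)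
    (hlive : ∀ c : Fin 1 × (Fin D → Option (Fin N)),
      c ∈ Set.range e ↔ ∀ (f : Fin D) (j : Fin N), c.2 f = some j → j ∈ S c.1 f)
    (f₁ f₂ f₃ : Fin D) (h12 : f₁ ≠ f₂) (h13 : f₁ ≠ f₃) (h23 : f₂ ≠ f₃) (ha : a ≤ h) (hn2a : n ≤ 2 ^ a)
    (hnC : n ≤ ∑ i ∈ Finset.range (m₁ + m₂ + m₃ + 2 + 1), a.choose i)
    (hlev₁ : ∑ i ∈ Finset.range (m₁ + 1), a.choose i ≤ (S 0 f₁).card)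
    (hlev₂ : ∑ i ∈ Finset.range (m₂ + 1), a.choose i ≤ (S 0 f₂).card)
    (hlev₃ : ∑ i ∈ Finset.range (m₃ + 1), a.choose i ≤ (S 0 f₃).card) :
    ∃ v : Fin n → Finset (Fin h), Function.Injective v ∧
      ∀ T : Fin 1 → Option (Fin D × Fin N) → Fin h → ℂ,
        (Matrix.of fun x x' : Fin n => ∏ a ∈ v x,
          (T (e x').1 none a + ∑ f : Fin D, ((e x').2 f).elim 0 fun j => T (e x').1 (some (f, j)) a)).det = 0 := by
  classical
  obtain ⟨hv, hSmall⟩ := smallRows_props h a (m₁ + m₂ + m₃ + 2) n ha hn2a hnC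
  refine ⟨_, hv, fun T => ?_⟩
  have hall : ∀ i : Fin n,
      (rowsSmallFirst a (m₁ + m₂ + m₃ + 2 + 1) n hn2a i).map (Fin.castLEEmb ha) ⊆
        (Finset.univ : Finset (Fin a)).map (Fin.castLEEmb ha) ∧
      ((rowsSmallFirst a (m₁ + m₂ + m₃ + 2 + 1) n hn2a i).map (Fin.castLEEmb ha)).card ≤ m₁ + m₂ + m₃ + 2 := by
    intro i
    have : i ∈ (Finset.univ.filter fun i : Fin n =>
        (rowsSmallFirst a (m₁ + m₂ + m₃ + 2 + 1) n hn2a i).map (Fin.castLEEmb ha) ⊆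
          (Finset.univ : Finset (Fin a)).map (Fin.castLEEmb ha) ∧
        ((rowsSmallFirst a (m₁ + m₂ + m₃ + 2 + 1) n hn2a i).map (Fin.castLEEmb ha)).card ≤ m₁ + m₂ + m₃ + 2) := by
      rw [hSmall]; exact Finset.mem_univ i
    exact (Finset.mem_filter.mp this).2
  have hAcard : ((Finset.univ : Finset (Fin a)).map (Fin.castLEEmb ha)).card = a := by simp
  exact det_eq_zero_of_three_slots_levels h m₁ m₂ m₃ 1 D N n ((Finset.univ : Finset (Fin a)).map (Fin.castLEEmb ha)) _
    (fun i => (hall i).1) (fun i => (hall i).2) S e he hlive 0 f₁ f₂ f₃ h12 h13 h23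
    (by rw [hAcard]; exact hlev₁) (by rw [hAcard]; exact hlev₂) (by rw [hAcard]; exact hlev₃) T

/-- `k!·n ≤ (a + 1 − k)^k` gives `n ≤ C(a,k)`, hence `n ≤ Σ_{i<d+1} C(a,i)` for `k ≤ d` and `n ≤ 2^a`. -/
theorem n_le_of_factorial_mul_le (n a k d : ℕ) (hk : k ≤ d) (hle : k.factorial * n ≤ (a + 1 - k) ^ k) :
    n ≤ ∑ i ∈ Finset.range (d + 1), a.choose i ∧ n ≤ 2 ^ a := by
  have h1 := Nat.pow_sub_le_descFactorial a k
  rw [Nat.descFactorial_eq_factorial_mul_choose] at h1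
  have h2 : n ≤ a.choose k := Nat.le_of_mul_le_mul_left (hle.trans h1) (Nat.factorial_pos k)
  exact ⟨h2.trans (Finset.single_le_sum (f := fun i => a.choose i) (fun i _ => Nat.zero_le _)
    (Finset.mem_range.mpr (by omega))), h2.trans (Nat.choose_le_two_pow a k)⟩

/-- Cover of pattern (2,0,0): if the `univ` leaf fails, the second slot is wide and the `(2,1,0)` leaf inside `a = s₂ − 1` fires. -/
theorem cover200 (h s₁ s₂ s₃ n : ℕ) (hh : 2 ^ 40 ≤ h) (hs₁N : s₁ ≤ (h + h) ^ 2) (hs₂h : s₂ ≤ h) (hs₃₂ : s₃ ≤ s₂)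
    (hn : n = (s₁ + 1) * (s₂ + 1) * (s₃ + 1)) (hU : (h - 3) ^ 4 < 24 * n) :
    120 * n ≤ (s₂ - 1 + 1 - 5) ^ 5 := by
  set t := s₂ + 1 with ht
  have hnt : n ≤ ((h + h) ^ 2 + 1) * (t * t) := by
    rw [hn, mul_assoc]; exact Nat.mul_le_mul (by omega) (Nat.mul_le_mul le_rfl (by omega))
  obtain ⟨c, rfl⟩ : ∃ c, h = c + 3 := ⟨h - 3, by omega⟩
  rw [show c + 3 - 3 = c by omega] at hU
  have hc : 2 ^ 39 ≤ c := by omega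
  -- `c < 11 t`
  have hct : c < 11 * t := by
    by_contra hle
    push Not at hle
    have h1 : 11 * t * (11 * t) ≤ c * c := Nat.mul_le_mul hle hle
    have h2 : (c + 3 + (c + 3)) ^ 2 + 1 ≤ 5 * (c * c) := by nlinarith
    have h3 : 24 * n ≤ 24 * ((5 * (c * c)) * (t * t)) :=
      Nat.mul_le_mul_left _ (hnt.trans (Nat.mul_le_mul_right _ h2))
    have h4 : 24 * ((5 * (c * c)) * (t * t)) * 121 ≤ 120 * (c * c) * (c * c) := by
      have := Nat.mul_le_mul_left (120 * (c * c)) h1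
      nlinarith [this]
    nlinarith [h3, h4]
  obtain ⟨w, hw⟩ : ∃ w, t = w + 6 := ⟨t - 6, by omega⟩
  rw [show s₂ - 1 + 1 - 5 = w by omega]
  rw [hw] at hnt hct
  have hw30 : 2 ^ 30 ≤ w := by omega
  have G0 : (c + 3 + (c + 3)) ^ 2 + 1 ≤ 485 * ((w + 6) * (w + 6)) := by nlinarith
  have G1 : 120 * n ≤ 120 * ((485 * ((w + 6) * (w + 6))) * ((w + 6) * (w + 6))) :=
    Nat.mul_le_mul_left _ (hnt.trans (Nat.mul_le_mul_right _ G0))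
  have G2 : 2 ^ 30 * (w * (w * (w * w))) ≤ w * (w * (w * (w * w))) := Nat.mul_le_mul_right _ hw30
  have G3 : 2 ^ 30 * (w * (w * w)) ≤ w * (w * (w * w)) := Nat.mul_le_mul_right _ hw30
  have G4 : 2 ^ 30 * (w * w) ≤ w * (w * w) := Nat.mul_le_mul_right _ hw30
  have G5 : 2 ^ 30 * w ≤ w * w := Nat.mul_le_mul_right _ hw30
  clear hU hct hn hs₁N hs₂h hs₃₂ hnt hw ht
  nlinarith [G1, G2, G3, G4, G5]

/-- **Pattern (2,0,0), three live slots.** -/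
theorem pieceKill3_p200 (h : ℕ) (hh : 2 ^ 40 ≤ h) (S : Fin 1 → Fin D → Finset (Fin N))
    (e : Fin n → Fin 1 × (Fin D → Option (Fin N))) (he : Function.Injective e)
    (hlive : ∀ c : Fin 1 × (Fin D → Option (Fin N)),
      c ∈ Set.range e ↔ ∀ (f : Fin D) (j : Fin N), c.2 f = some j → j ∈ S c.1 f)
    (f₁ f₂ f₃ : Fin D) (h12 : f₁ ≠ f₂) (h13 : f₁ ≠ f₃) (h23 : f₂ ≠ f₃)
    (hs₁ : ∑ i ∈ Finset.range 3, h.choose i ≤ (S 0 f₁).card) (hs₁N : (S 0 f₁).card ≤ (h + h) ^ 2)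
    (hs₂h : (S 0 f₂).card ≤ h) (hs₃₂ : (S 0 f₃).card ≤ (S 0 f₂).card) (hs₃ : 1 ≤ (S 0 f₃).card)
    (hn : n = ((S 0 f₁).card + 1) * ((S 0 f₂).card + 1) * ((S 0 f₃).card + 1)) :
    ∃ v : Fin n → Finset (Fin h), Function.Injective v ∧
      ∀ T : Fin 1 → Option (Fin D × Fin N) → Fin h → ℂ,
        (Matrix.of fun x x' : Fin n => ∏ a ∈ v x,
          (T (e x').1 none a + ∑ f : Fin D, ((e x').2 f).elim 0 fun j => T (e x').1 (some (f, j)) a)).det = 0 := by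
  classical
  set s₁ := (S 0 f₁).card with hs₁def
  set s₂ := (S 0 f₂).card with hs₂def
  set s₃ := (S 0 f₃).card with hs₃def
  by_cases hU : 24 * n ≤ (h - 3) ^ 4
  · -- leaf (2,0,0) at `a = h`
    obtain ⟨hnC, hn2⟩ := n_le_of_factorial_mul_le n h 4 4 le_rfl
      (by rw [show Nat.factorial 4 = 24 by rfl, show h + 1 - 4 = h - 3 by omega]; exact hU)
    exact leaf3_allSmall h 2 0 0 h S e he hlive f₁ f₂ f₃ h12 h13 h23 le_rfl hn2 hnC hs₁
      (by simp only [zero_add, Finset.sum_range_one, Nat.choose_zero_right]; omega)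
      (by simp only [zero_add, Finset.sum_range_one, Nat.choose_zero_right]; omega)
  · -- leaf (2,1,0) inside `a = s₂ - 1`
    push Not at hU
    have hcov := cover200 h s₁ s₂ s₃ n hh hs₁N hs₂h hs₃₂ hn hU
    obtain ⟨hnC, hn2⟩ := n_le_of_factorial_mul_le n (s₂ - 1) 5 5 le_rfl
      (by rw [show Nat.factorial 5 = 120 by rfl]; exact hcov)
    refine leaf3_allSmall h 2 1 0 (s₂ - 1) S e he hlive f₁ f₂ f₃ h12 h13 h23 (by omega) hn2 hnC ?_ ?_ ?_
    · exact (Finset.sum_le_sum fun i _ => Nat.choose_le_choose i (by omega : s₂ - 1 ≤ h)).trans hs₁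
    · simp [Finset.sum_range_succ]; omega
    · simp only [zero_add, Finset.sum_range_one, Nat.choose_zero_right]; omega

/-- Pure arithmetic: `1474560 (h+1)⁴ < 100001·((2h)²+2)²` for `h ≥ 200`. -/
theorem aux_quartic (h : ℕ) (hh : 200 ≤ h) :
    (h + 1) * (h + 1) * (1474560 * ((h + 1) * (h + 1))) < ((h + h) ^ 2 + 2) * ((h + h) ^ 2 + 2) * 100001 := by
  have G : 200 * (h * (h * h)) ≤ h * (h * (h * h)) := Nat.mul_le_mul_right _ hh
  have G2 : 200 * (h * h) ≤ h * (h * h) := Nat.mul_le_mul_right _ hh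
  have G3 : 200 * h ≤ h * h := Nat.mul_le_mul_right _ hh
  nlinarith [G, G2, G3]

/-- Core of the (0,0,0) cover, `Y ≥ 13`: `X³ ≤ 384(h+1)Y`, `Y⁴ ≤ 3840(h+1)X` and `(h+1)XY ≥ (2h)²+2` are incompatible (`h ≥ 2^40`). -/
theorem cover000_core (h X Y : ℕ) (hh : 2 ^ 40 ≤ h) (hY : 13 ≤ Y) (hYX : Y ≤ X)
    (hXY : (h + h) ^ 2 + 2 ≤ (h + 1) * X * Y)
    (hA : (X - 5) ^ 4 < 24 * ((h + 1) * X * Y)) (hB : (Y - 6) ^ 5 < 120 * ((h + 1) * X * Y)) : False := by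
  have hXpos : 0 < X := by omega
  have hYpos : 0 < Y := by omega
  have hX4 : X ^ 4 ≤ 16 * (X - 5) ^ 4 := by
    calc X ^ 4 ≤ (2 * (X - 5)) ^ 4 := Nat.pow_le_pow_left (by omega) 4
      _ = 16 * (X - 5) ^ 4 := by ring
  have hY5 : Y ^ 5 ≤ 32 * (Y - 6) ^ 5 := by
    calc Y ^ 5 ≤ (2 * (Y - 6)) ^ 5 := Nat.pow_le_pow_left (by omega) 5
      _ = 32 * (Y - 6) ^ 5 := by ring
  have hX3 : X * X * X ≤ 384 * (h + 1) * Y := by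
    have h1 : X ^ 4 ≤ 16 * (24 * ((h + 1) * X * Y)) := hX4.trans (Nat.mul_le_mul_left 16 hA.le)
    rw [show 16 * (24 * ((h + 1) * X * Y)) = X * (384 * (h + 1) * Y) by ring, show X ^ 4 = X * (X * X * X) by ring] at h1
    exact Nat.le_of_mul_le_mul_left h1 hXpos
  have hY4 : Y * Y * Y * Y ≤ 3840 * (h + 1) * X := by
    have h1 : Y ^ 5 ≤ 32 * (120 * ((h + 1) * X * Y)) := hY5.trans (Nat.mul_le_mul_left 32 hB.le)
    rw [show 32 * (120 * ((h + 1) * X * Y)) = Y * (3840 * (h + 1) * X) by ring,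
      show Y ^ 5 = Y * (Y * Y * Y * Y) by ring] at h1
    exact Nat.le_of_mul_le_mul_left h1 hYpos
  have hX2Y3 : X * X * (Y * Y * Y) ≤ 1474560 * ((h + 1) * (h + 1)) := by
    have h1 : X * X * X * (Y * Y * Y) ≤ 384 * (h + 1) * Y * (Y * Y * Y) := Nat.mul_le_mul_right _ hX3
    have h3 : 384 * (h + 1) * (Y * Y * Y * Y) ≤ 384 * (h + 1) * (3840 * (h + 1) * X) := Nat.mul_le_mul_left _ hY4
    rw [show 384 * (h + 1) * Y * (Y * Y * Y) = 384 * (h + 1) * (Y * Y * Y * Y) by ring] at h1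
    have h4 := h1.trans h3
    rw [show X * X * X * (Y * Y * Y) = X * (X * X * (Y * Y * Y)) by ring,
      show 384 * (h + 1) * (3840 * (h + 1) * X) = X * (1474560 * ((h + 1) * (h + 1))) by ring] at h4
    exact Nat.le_of_mul_le_mul_left h4 hXpos
  have hsq : ((h + h) ^ 2 + 2) * ((h + h) ^ 2 + 2) ≤ ((h + 1) * X * Y) * ((h + 1) * X * Y) := Nat.mul_le_mul hXY hXY
  have hYb : Y ≤ 100000 := by
    by_contra hlt
    push Not at hlt
    have h2 : (h + 1) * (h + 1) * (X * X * (Y * Y * Y)) ≤ (h + 1) * (h + 1) * (1474560 * ((h + 1) * (h + 1))) :=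
      Nat.mul_le_mul_left _ hX2Y3
    have h3 : ((h + h) ^ 2 + 2) * ((h + h) ^ 2 + 2) * 100001 ≤ ((h + 1) * X * Y) * ((h + 1) * X * Y) * Y :=
      Nat.mul_le_mul hsq hlt
    rw [show ((h + 1) * X * Y) * ((h + 1) * X * Y) * Y = (h + 1) * (h + 1) * (X * X * (Y * Y * Y)) by ring] at h3
    have := aux_quartic h (by omega)
    omega
  have hX3' : X * X * X ≤ 38400000 * (h + 1) :=
    hX3.trans (by rw [show 38400000 * (h + 1) = 384 * (h + 1) * 100000 by ring]; exact Nat.mul_le_mul_left _ hYb)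
  have hXlo : (h + h) ^ 2 + 2 ≤ (h + 1) * X * 100000 := hXY.trans (Nat.mul_le_mul_left _ hYb)
  have hX25 : h ≤ 25001 * X := by
    by_contra hlt
    have h1 : 25001 * X + 1 ≤ h := by omega
    have h2 := Nat.mul_le_mul_left (4 * (h + 1)) h1
    nlinarith [hXlo, h2]
  have h3 : h * h * h ≤ 25001 * X * (25001 * X) * (25001 * X) := Nat.mul_le_mul (Nat.mul_le_mul hX25 hX25) hX25
  have h4 : 2 ^ 40 * (2 ^ 40 * h) ≤ h * h * h := by
    have := Nat.mul_le_mul hh (Nat.mul_le_mul_right h hh)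
    simpa [mul_comm, mul_assoc, mul_left_comm] using this
  nlinarith [h3, hX3', h4]

/-- Cover of pattern (0,0,0): with `n ≥ (2h)²+2` and all sizes `≤ h`, one of the leaves (1,1,0)@`s₂−1`, (1,1,1)@`s₃−1` fires (`h ≥ 2^40`). -/
theorem cover000 (h s₁ s₂ s₃ n : ℕ) (hh : 2 ^ 40 ≤ h) (hs₁h : s₁ ≤ h) (hs₃₂ : s₃ ≤ s₂)
    (hn : n = (s₁ + 1) * (s₂ + 1) * (s₃ + 1)) (hnlo : (h + h) ^ 2 + 2 ≤ n)
    (hA : (s₂ - 1 + 1 - 4) ^ 4 < 24 * n) (hB : (s₃ - 1 + 1 - 5) ^ 5 < 120 * n) : False := by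
  set X := s₂ + 1 with hX
  set Y := s₃ + 1 with hY
  have hnXY : n ≤ (h + 1) * X * Y := by rw [hn]; exact Nat.mul_le_mul (Nat.mul_le_mul_right _ (by omega)) le_rfl
  have hXY : (h + h) ^ 2 + 2 ≤ (h + 1) * X * Y := hnlo.trans hnXY
  have hA' : (X - 5) ^ 4 < 24 * ((h + 1) * X * Y) := by
    rw [show s₂ - 1 + 1 - 4 = X - 5 by omega] at hA; exact hA.trans_le (Nat.mul_le_mul_left _ hnXY)
  have hB' : (Y - 6) ^ 5 < 120 * ((h + 1) * X * Y) := by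
    rw [show s₃ - 1 + 1 - 5 = Y - 6 by omega] at hB; exact hB.trans_le (Nat.mul_le_mul_left _ hnXY)
  rcases lt_or_ge Y 13 with hYs | hYb
  · -- `Y ≤ 12`: then `X ≥ h/4`, and leaf A must fire
    have hXY12 : (h + 1) * X * Y ≤ (h + 1) * X * 12 := Nat.mul_le_mul_left _ (by omega)
    have hX4 : h ≤ 4 * X := by
      by_contra hlt
      have h1 : 4 * X + 1 ≤ h := by omega
      have h2 := Nat.mul_le_mul_left (3 * (h + 1)) h1
      nlinarith [hXY, hXY12, h2]
    obtain ⟨w, hw⟩ : ∃ w, X = w + 5 := ⟨X - 5, by omega⟩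
    rw [hw, show w + 5 - 5 = w by omega] at hA'
    rw [hw] at hX4
    have hw36 : 2 ^ 36 ≤ w := by omega
    have h1 : 24 * ((h + 1) * (w + 5) * Y) ≤ 24 * ((4 * (w + 5) + 1) * (w + 5) * 12) :=
      Nat.mul_le_mul_left _ (Nat.mul_le_mul (Nat.mul_le_mul_right _ (by omega)) (by omega))
    have G3 : 2 ^ 36 * (w * (w * w)) ≤ w * (w * (w * w)) := Nat.mul_le_mul_right _ hw36
    have G4 : 2 ^ 36 * (w * w) ≤ w * (w * w) := Nat.mul_le_mul_right _ hw36
    have G5 : 2 ^ 36 * w ≤ w * w := Nat.mul_le_mul_right _ hw36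
    have h2 := hA'.trans_le h1
    clear hA hB hA' hB' h1 hnXY hXY hXY12 hn hnlo hX4 hw hX hY
    nlinarith [h2, G3, G4, G5]
  · exact cover000_core h X Y hh hYb (by omega) hXY hA' hB'

/-- **Pattern (0,0,0), three live slots.** -/
theorem pieceKill3_p000 (h : ℕ) (hh : 2 ^ 40 ≤ h) (S : Fin 1 → Fin D → Finset (Fin N))
    (e : Fin n → Fin 1 × (Fin D → Option (Fin N))) (he : Function.Injective e)
    (hlive : ∀ c : Fin 1 × (Fin D → Option (Fin N)),
      c ∈ Set.range e ↔ ∀ (f : Fin D) (j : Fin N), c.2 f = some j → j ∈ S c.1 f)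
    (f₁ f₂ f₃ : Fin D) (h12 : f₁ ≠ f₂) (h13 : f₁ ≠ f₃) (h23 : f₂ ≠ f₃)
    (hs₁h : (S 0 f₁).card ≤ h) (hs₂₁ : (S 0 f₂).card ≤ (S 0 f₁).card) (hs₃₂ : (S 0 f₃).card ≤ (S 0 f₂).card)
    (hs₃ : 1 ≤ (S 0 f₃).card)
    (hn : n = ((S 0 f₁).card + 1) * ((S 0 f₂).card + 1) * ((S 0 f₃).card + 1)) (hnlo : (h + h) ^ 2 + 2 ≤ n) :
    ∃ v : Fin n → Finset (Fin h), Function.Injective v ∧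
      ∀ T : Fin 1 → Option (Fin D × Fin N) → Fin h → ℂ,
        (Matrix.of fun x x' : Fin n => ∏ a ∈ v x,
          (T (e x').1 none a + ∑ f : Fin D, ((e x').2 f).elim 0 fun j => T (e x').1 (some (f, j)) a)).det = 0 := by
  classical
  set s₁ := (S 0 f₁).card with hs₁def
  set s₂ := (S 0 f₂).card with hs₂def
  set s₃ := (S 0 f₃).card with hs₃def
  by_cases hA : 24 * n ≤ (s₂ - 1 + 1 - 4) ^ 4
  · obtain ⟨hnC, hn2⟩ := n_le_of_factorial_mul_le n (s₂ - 1) 4 4 le_rfl (by rw [show Nat.factorial 4 = 24 by rfl]; exact hA)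
    refine leaf3_allSmall h 1 1 0 (s₂ - 1) S e he hlive f₁ f₂ f₃ h12 h13 h23 (by omega) hn2 hnC ?_ ?_ ?_
    · simp [Finset.sum_range_succ]; omega
    · simp [Finset.sum_range_succ]; omega
    · simp only [zero_add, Finset.sum_range_one, Nat.choose_zero_right]; omega
  by_cases hB : 120 * n ≤ (s₃ - 1 + 1 - 5) ^ 5
  · obtain ⟨hnC, hn2⟩ := n_le_of_factorial_mul_le n (s₃ - 1) 5 5 le_rfl (by rw [show Nat.factorial 5 = 120 by rfl]; exact hB)
    refine leaf3_allSmall h 1 1 1 (s₃ - 1) S e he hlive f₁ f₂ f₃ h12 h13 h23 (by omega) hn2 hnC ?_ ?_ ?_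
    · simp [Finset.sum_range_succ]; omega
    · simp [Finset.sum_range_succ]; omega
    · simp [Finset.sum_range_succ]; omega
  exact (cover000 h s₁ s₂ s₃ n hh hs₁h hs₃₂ hn hnlo (not_le.mp hA) (not_le.mp hB)).elim

end Summit.ValiantsHypothesis.ValiantsHypothesis.Theorems.BarrierLever.SimplexJoin
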